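/-
HONEST FRAMING: certified error envelopes and provably optimal rounding/accumulation schemes for
low-precision formats under stated cost models; every table by two implementations; no hardware
or vendor claims.
-/
import Summits.Ventures.CertifiedArithmetic.LowPrec.OptDemotionAllLines

/-!
# The demotion law (Theorem T8), part 6f: TAIL FACTS of the full line family (opt gen 11, (iii″)(R10))

Structural inequalities satisfied by every member `(α, λ)` of the full line family `L_t = allLines u t`
(part 6a) of a summation tree `t` with tree polynomial `M_t = 1 + μ_t` (`0 ≤ u ≤ 1`), stated by the opt
seat (OPTIMA.md §B T8(b)(iii″)(R10), "the PROVED tail facts for sloped lines", checked there on all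
lines of 962 node shapes, tight) and used as hypotheses of every abstract node lemma beyond the
single-line interface (lean g9 `code/lean/demote_g9/absnode_v2.py`, `absnode_v3.py`):

* `allLines_slope_le_node` — at a node, EVERY line has `λ ≤ μ_t - u`;
* `allLines_sloped_intercept_le` — a SLOPED line (`λ > 0`) has `α ≤ μ_t - u²`
  ("an intercept equal to `μ` forces slope `0`");
* `allLines_sloped_tail` — a sloped line has `u·α + (1 - u²)·λ ≤ (μ_t - u) + u²(1 - u)` (tight: the
  line `(u, u)` of the three-term chain).
All three by induction over the four transforms; a sloped line of a node `a·b` that is a transpose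
`F3(α_b, λ_b) = (u + μ_a + uλ_b, α_b)` forces `b` to be a node (a leaf has only the line `(0,0)`).
-/

namespace Summit.Ventures.CertifiedArithmetic.LowPrec.Opt

open Literature.ComputerArithmetic.JeannerodRump2018
open Literature.ComputerArithmetic.JeannerodRump2018.SumTree

/-- At a node the tree polynomial exceeds `1` by at least `u`: `μ_{a·b} ≥ μ_a + u + u μ_b ≥ u`. -/
theorem treeM_node_sub_one_ge_u {u : ℚ} (hu0 : 0 ≤ u) (hu1 : u ≤ 1) (a b : SumTree) :
    u ≤ treeM u (.node a b) - 1 := by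
  have h := (treeM_node_sub_one_ge hu0 hu1 a b).1
  have ha := one_le_treeM hu0 a
  have hb := one_le_treeM hu0 b
  nlinarith [mul_nonneg hu0 (by linarith : (0 : ℚ) ≤ treeM u b - 1)]

/-- (T2) At a node EVERY line of the full family has slope `λ ≤ μ_t - u`. -/
theorem allLines_slope_le_node {u : ℚ} (hu0 : 0 ≤ u) (hu1 : u ≤ 1) (a b : SumTree) :
    ∀ l ∈ allLines u (.node a b), l.2 ≤ treeM u (.node a b) - 1 - u := by
  intro l hl
  have hN := treeM_node_sub_one_ge hu0 hu1 a b
  have hMa := one_le_treeM hu0 a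
  have hMb := one_le_treeM hu0 b
  rcases mem_allLines_node hl with ⟨m, hm, rfl⟩ | ⟨m, hm, rfl⟩ | ⟨m, hm, rfl⟩ | ⟨m, hm, rfl⟩
  · obtain ⟨-, h1, -, -⟩ := allLines_bounds hu0 hu1 a m hm
    dsimp only; nlinarith [mul_nonneg hu0 (by linarith : (0 : ℚ) ≤ treeM u b - 1), hN.1]
  · obtain ⟨-, h1, -, -⟩ := allLines_bounds hu0 hu1 b m hm
    dsimp only; nlinarith [mul_nonneg hu0 (by linarith : (0 : ℚ) ≤ treeM u a - 1), hN.2]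
  · obtain ⟨-, -, -, h3⟩ := allLines_bounds hu0 hu1 b m hm
    dsimp only; nlinarith [mul_nonneg hu0 (by linarith : (0 : ℚ) ≤ treeM u a - 1), hN.2]
  · obtain ⟨-, -, -, h3⟩ := allLines_bounds hu0 hu1 a m hm
    dsimp only; nlinarith [mul_nonneg hu0 (by linarith : (0 : ℚ) ≤ treeM u b - 1), hN.1]

/-- (T2') For every tree: a line of the full family has `λ ≤ μ_t - u` or is the leaf line `(0,0)`
with `λ = 0`. -/
theorem allLines_slope_le_or {u : ℚ} (hu0 : 0 ≤ u) (hu1 : u ≤ 1) :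
    ∀ (t : SumTree) (l : ℚ × ℚ), l ∈ allLines u t → l.2 ≤ treeM u t - 1 - u ∨ l.2 = 0
  | .leaf x, l, hl => by simp at hl; subst hl; simp
  | .node a b, l, hl => Or.inl (allLines_slope_le_node hu0 hu1 a b l hl)

/-- (T1) A SLOPED line (`λ > 0`) of the full family has intercept `α ≤ μ_t - u²`. -/
theorem allLines_sloped_intercept_le {u : ℚ} (hu0 : 0 ≤ u) (hu1 : u ≤ 1) :
    ∀ (t : SumTree) (l : ℚ × ℚ), l ∈ allLines u t → 0 < l.2 → l.1 ≤ treeM u t - 1 - u ^ 2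
  | .leaf x, l, hl, hpos => by simp at hl; subst hl; simp at hpos
  | .node a b, l, hl, hpos => by
      have hN := treeM_node_sub_one_ge hu0 hu1 a b
      have hMa := one_le_treeM hu0 a
      have hMb := one_le_treeM hu0 b
      rcases mem_allLines_node hl with ⟨m, hm, rfl⟩ | ⟨m, hm, rfl⟩ | ⟨m, hm, rfl⟩ | ⟨m, hm, rfl⟩
      · have ih := allLines_sloped_intercept_le hu0 hu1 a m hm hpos
        dsimp only; nlinarith [hN.1]
      · have ih := allLines_sloped_intercept_le hu0 hu1 b m hm hpos
        dsimp only; nlinarith [hN.2]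
      · -- transpose of a line of b: slope = m.1 > 0 forces b to be a node, so m.2 ≤ μ_b - u
        dsimp only at hpos ⊢
        rcases allLines_slope_le_or hu0 hu1 b m hm with h2 | h2
        · nlinarith [hN.1, mul_le_mul_of_nonneg_left h2 hu0]
        · obtain ⟨-, -, -, h3⟩ := allLines_bounds hu0 hu1 b m hm
          -- m.2 = 0: α = u + μ_a ≤ μ - u μ_b ... need μ_b ≥ u: b is a node since m.1 > 0
          cases b with
          | leaf y => simp at hm; subst hm; simp at hpos
          | node b1 b2 =>
              have hub := treeM_node_sub_one_ge_u hu0 hu1 b1 b2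
              rw [h2, mul_zero, add_zero]
              nlinarith [hN.1, mul_le_mul_of_nonneg_left hub hu0]
      · dsimp only at hpos ⊢
        rcases allLines_slope_le_or hu0 hu1 a m hm with h2 | h2
        · nlinarith [hN.2, mul_le_mul_of_nonneg_left h2 hu0]
        · cases a with
          | leaf y => simp at hm; subst hm; simp at hpos
          | node a1 a2 =>
              have hua := treeM_node_sub_one_ge_u hu0 hu1 a1 a2
              rw [h2, mul_zero, add_zero]
              nlinarith [hN.2, mul_le_mul_of_nonneg_left hua hu0]

/-- (T3) A SLOPED line of the full family satisfies `u·α + (1 - u²)·λ ≤ (μ_t - u) + u²(1 - u)`. -/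
theorem allLines_sloped_tail {u : ℚ} (hu0 : 0 ≤ u) (hu1 : u ≤ 1) :
    ∀ (t : SumTree) (l : ℚ × ℚ), l ∈ allLines u t → 0 < l.2 →
      u * l.1 + (1 - u ^ 2) * l.2 ≤ (treeM u t - 1 - u) + u ^ 2 * (1 - u)
  | .leaf x, l, hl, hpos => by simp at hl; subst hl; simp at hpos
  | .node a b, l, hl, hpos => by
      have hN := treeM_node_sub_one_ge hu0 hu1 a b
      have hMa := one_le_treeM hu0 a
      have hMb := one_le_treeM hu0 b
      have hu2 : 0 ≤ 1 - u ^ 2 := by nlinarith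
      rcases mem_allLines_node hl with ⟨m, hm, rfl⟩ | ⟨m, hm, rfl⟩ | ⟨m, hm, rfl⟩ | ⟨m, hm, rfl⟩
      · have ih := allLines_sloped_tail hu0 hu1 a m hm hpos
        dsimp only
        have : u ^ 2 * treeM u b ≤ u * treeM u b := by nlinarith [mul_nonneg hu0 (by linarith : (0:ℚ) ≤ treeM u b)]
        nlinarith [hN.1]
      · have ih := allLines_sloped_tail hu0 hu1 b m hm hpos
        dsimp only
        have : u ^ 2 * treeM u a ≤ u * treeM u a := by nlinarith [mul_nonneg hu0 (by linarith : (0:ℚ) ≤ treeM u a)]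
        nlinarith [hN.2]
      · -- l = (u + μ_a + u m.2, m.1), m a line of b with m.1 > 0: b is a node
        dsimp only at hpos ⊢
        obtain ⟨h0, -, -, h3⟩ := allLines_bounds hu0 hu1 b m hm
        cases b with
        | leaf y => simp at hm; subst hm; simp at hpos
        | node b1 b2 =>
            have h2 := allLines_slope_le_node hu0 hu1 b1 b2 m hm
            -- u²λ_b + (1-u²)α_b ≤ u²(μ_b - u) + (1-u²)μ_b = μ_b - u³
            have k1 : u ^ 2 * m.2 ≤ u ^ 2 * (treeM u (.node b1 b2) - 1 - u) :=
              mul_le_mul_of_nonneg_left h2 (by positivity)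
            have k2 : (1 - u ^ 2) * m.1 ≤ (1 - u ^ 2) * (treeM u (.node b1 b2) - 1) :=
              mul_le_mul_of_nonneg_left h3 hu2
            nlinarith [hN.2, k1, k2]
      · dsimp only at hpos ⊢
        obtain ⟨h0, -, -, h3⟩ := allLines_bounds hu0 hu1 a m hm
        cases a with
        | leaf y => simp at hm; subst hm; simp at hpos
        | node a1 a2 =>
            have h2 := allLines_slope_le_node hu0 hu1 a1 a2 m hm
            have k1 : u ^ 2 * m.2 ≤ u ^ 2 * (treeM u (.node a1 a2) - 1 - u) :=
              mul_le_mul_of_nonneg_left h2 (by positivity)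
            have k2 : (1 - u ^ 2) * m.1 ≤ (1 - u ^ 2) * (treeM u (.node a1 a2) - 1) :=
              mul_le_mul_of_nonneg_left h3 hu2
            nlinarith [hN.1, k1, k2]

/-- NUMBERS: the tail fact (T3) is tight — the three-term chain `((x,y),z)` has the sloped line
`(u, u)` (the transposed μ-line of its pair) and `u·u + (1-u²)·u = (2u - u) + u²(1-u)` identically. -/
theorem allLines_tail_tight {u : ℚ} (hu0 : 0 ≤ u) (x y z : ℚ) :
    (u, u) ∈ allLines u (.node (.node (.leaf x) (.leaf y)) (.leaf z)) ∧
    u * u + (1 - u ^ 2) * u = (treeM u (.node (.node (.leaf x) (.leaf y)) (.leaf z)) - 1 - u)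
      + u ^ 2 * (1 - u) := by
  have h1 : max (1 + u) 1 = 1 + u := max_eq_left (by linarith)
  have h2 : min (1 + u) 1 = 1 := min_eq_right (by linarith)
  constructor
  · simp [allLines, treeM]
  · simp only [treeM, max_self, min_self, mul_one, h1, h2]
    ring

end Summit.Ventures.CertifiedArithmetic.LowPrec.Opt
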